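import Mathlib.MeasureTheory.Integral.MeanInequalities
import Mathlib.MeasureTheory.Integral.IntervalIntegral.Basic
import Mathlib.MeasureTheory.Integral.Bochner.Set
import Mathlib.Analysis.SpecialFunctions.Integrals.Basic
import Mathlib.Analysis.SpecialFunctions.Integrability.Basic
import Mathlib.Analysis.SpecialFunctions.Sqrt
import Mathlib.MeasureTheory.Measure.Prod
import Mathlib.MeasureTheory.Group.Measure
import Mathlib.MeasureTheory.Measure.Haar.Unique
import Mathlib.MeasureTheory.Measure.Lebesgue.EqHaar
import HarnessLib

/-!
# Hardy's inequality for primitives: `∫₀^ℓ |∫₀ˣ f|²/x² dx ≤ 4 ∫₀^ℓ |f|²`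

Analysis/Calculus support file (everything proved; no definitions, no named facts).
Hardy's integral inequality for `p = 2` (Hardy 1920/1925; Hardy–Littlewood–Pólya, *Inequalities*,
Thm. 327: `∫₀^∞ (F/x)² dx < 4 ∫₀^∞ f²` for `F(x) = ∫₀ˣ f`, `f ≥ 0`), in the forms needed to control
a Sobolev function near a zero by its derivative along a line ("Hardy near a hypersurface for
zero-trace functions"; cf. the interval Hardy inequalities of `RadialHardyTwoEdge`,
`HardyChainHalfLine` for `C¹` functions on `[r₁, r₂] ⊂ (0, ∞)`, which keep edge terms and do not reach
the singular endpoint):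

* `lintegral_sq_primitive_div_sq_le` — for `f : ℝ → [0, ∞]` a.e.-measurable on `(0, ℓ)`,
  `∫⁻_{(0,ℓ)} (∫⁻_{(0,x)} f)² / x² dx ≤ 4 ∫⁻_{(0,ℓ)} f²` (both sides in `[0, ∞]`, no finiteness
  assumption; `ℓ ≤ 0` is the empty statement);
* `lintegral_enorm_sq_intervalIntegral_div_sq_le` — for `h : ℝ → E` (real Banach space)
  a.e.-strongly measurable on `(b, b + ℓ)`: `∫⁻_{(b,b+ℓ)} ‖∫_b^t h‖² / (t - b)² dt ≤ 4 ∫⁻_{(b,b+ℓ)} ‖h‖²`,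
  i.e. Hardy's inequality `∫ ‖u‖²/dist(·, b)² ≤ 4 ∫ ‖u'‖²` for an absolutely continuous `u` vanishing
  at the left endpoint `b`, written for `u = ∫_b h`; and the mirror version at a right endpoint,
  `lintegral_enorm_sq_intervalIntegral_div_sq_le_right`.

## Proof (weighted Cauchy–Schwarz, no finiteness bootstrap)

For `0 < x`: `(∫₀ˣ f)² = (∫₀ˣ s^{-1/4} · s^{1/4} f)² ≤ (∫₀ˣ s^{-1/2} ds)(∫₀ˣ √s f²) = 2√x ∫₀ˣ √s f(s)² ds`,
hence `(∫₀ˣ f)²/x² ≤ ∫₀ˣ (2√x/x²) √s f(s)² ds`; integrating in `x ∈ (0, ℓ)` and exchanging the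
integrals (Tonelli on the triangle `0 < s < x < ℓ`),
`∫₀^ℓ (∫₀ˣ f)²/x² ≤ ∫₀^ℓ √s f(s)² (∫ₛ^ℓ 2√x/x² dx) ds = ∫₀^ℓ √s f(s)² · 4(1/√s - 1/√ℓ) ds ≤ 4 ∫₀^ℓ f²`.
The constant `4 = (p/(p-1))^p` is Hardy's sharp constant.

## Mathlib / tree search

Mathlib has no Hardy inequality (searched `Hardy`, `hardy`: only Hardy–Littlewood maximal function
material and `Mathlib/Analysis/SumIntegralComparisons`); used: `ENNReal.lintegral_mul_le_Lp_mul_Lq`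
(Hölder), `MeasureTheory.lintegral_lintegral_swap` (Tonelli), `integral_rpow`,
`intervalIntegral.intervalIntegrable_rpow'`, `Real.hasDerivAt_sqrt`. Tree: `Literature.Analysis.Calculus`
Hardy files (`HardyHalfLine`, `HardyExterior`, `RadialHardyTwoEdge`, `HardyChainHalfLine`,
`HardyLogarithmic`, `HardyWholeSpace`) — all for `C¹` functions away from the singular point.

## References

* G. H. Hardy, J. E. Littlewood, G. Pólya, *Inequalities*, 2nd ed., Cambridge (1952), Thm. 327.
  [HardyLittlewoodPolya1952]
-/

noncomputable section

open MeasureTheory Set Filter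
open scoped ENNReal NNReal Topology

namespace Literature.Analysis.Calculus

/-! ## Two power integrals -/

/-- `∫_{(0,x)} ds/√s = 2√x` in `[0, ∞]` (`0 < x`). [folklore] -/
theorem lintegral_Ioo_inv_sqrt {x : ℝ} (hx : 0 < x) :
    ∫⁻ s in Ioo 0 x, ENNReal.ofReal ((√s)⁻¹) = ENNReal.ofReal (2 * √x) := by
  have heq : ∀ s ∈ Ioo (0 : ℝ) x, (√s)⁻¹ = s ^ (-(1 / 2 : ℝ)) := fun s hs => by
    rw [Real.rpow_neg hs.1.le, Real.sqrt_eq_rpow]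
  have hint : IntegrableOn (fun s : ℝ => s ^ (-(1 / 2 : ℝ))) (Ioo 0 x) volume := by
    have h := (intervalIntegral.intervalIntegrable_rpow' (a := 0) (b := x)
      (by norm_num : (-1 : ℝ) < -(1 / 2))).1
    exact h.mono_set Ioo_subset_Ioc_self
  calc ∫⁻ s in Ioo 0 x, ENNReal.ofReal ((√s)⁻¹)
      = ∫⁻ s in Ioo 0 x, ENNReal.ofReal (s ^ (-(1 / 2 : ℝ))) :=
        setLIntegral_congr_fun measurableSet_Ioo fun s hs => by rw [heq s hs]
    _ = ENNReal.ofReal (∫ s in Ioo 0 x, s ^ (-(1 / 2 : ℝ))) :=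
        (ofReal_integral_eq_lintegral_ofReal hint
          ((ae_restrict_iff' measurableSet_Ioo).2 (ae_of_all _ fun s hs =>
            Real.rpow_nonneg hs.1.le _))).symm
    _ = ENNReal.ofReal (2 * √x) := by
        rw [← integral_Ioc_eq_integral_Ioo, ← intervalIntegral.integral_of_le hx.le,
          integral_rpow (Or.inl (by norm_num)), Real.sqrt_eq_rpow]
        congr 1
        have h0 : (0 : ℝ) ^ (-(1 / 2 : ℝ) + 1) = 0 := Real.zero_rpow (by norm_num)
        rw [h0, sub_zero, show (-(1 / 2 : ℝ) + 1) = 1 / 2 by norm_num,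
          div_eq_iff (by norm_num : (1 / 2 : ℝ) ≠ 0)]
        ring

/-- The kernel integral of the proof: `√s ∫_{(s,ℓ)} 2√x/x² dx = 4√s (1/√s - 1/√ℓ)₊ ≤ 4`
(`0 < s`; the primitive of `2√x/x² = 2/(x√x)` is `-4/√x`). [folklore] -/
theorem sqrt_mul_lintegral_Ioo_kernel_le {s : ℝ} (hs : 0 < s) (ℓ : ℝ) :
    ENNReal.ofReal (√s) * ∫⁻ x in Ioo s ℓ, ENNReal.ofReal (2 * √x / x ^ 2) ≤ 4 := by
  rcases le_or_gt ℓ s with hℓ | hℓ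
  · rw [Ioo_eq_empty_of_le hℓ, Measure.restrict_empty, lintegral_zero_measure, mul_zero]
    exact zero_le
  have hpos : ∀ x ∈ uIcc s ℓ, 0 < x := fun x hx => by
    rw [uIcc_of_le hℓ.le] at hx
    exact hs.trans_le hx.1
  -- the primitive `-4/√x`
  have hderiv : ∀ x ∈ uIcc s ℓ, HasDerivAt (fun y : ℝ => -4 * (√y)⁻¹) (2 * √x / x ^ 2) x := by
    intro x hx
    have hx0 : 0 < x := hpos x hx
    have hsx : √x ≠ 0 := (Real.sqrt_pos.2 hx0).ne'
    have h := ((Real.hasDerivAt_sqrt hx0.ne').inv hsx).const_mul (-4)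
    have heq : -4 * (-(1 / (2 * √x)) / √x ^ 2) = 2 * √x / x ^ 2 := by
      rw [Real.sq_sqrt hx0.le]
      field_simp
      rw [Real.sq_sqrt hx0.le]
      ring
    rw [heq] at h
    exact h
  have hcont : ContinuousOn (fun x : ℝ => 2 * √x / x ^ 2) (uIcc s ℓ) := by
    refine ContinuousOn.div (by fun_prop) (by fun_prop) fun x hx => ?_
    exact pow_ne_zero _ (hpos x hx).ne'
  have hval : ∫ x in s..ℓ, 2 * √x / x ^ 2 = -4 * (√ℓ)⁻¹ - -4 * (√s)⁻¹ :=
    intervalIntegral.integral_eq_sub_of_hasDerivAt hderiv (hcont.intervalIntegrable)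
  have hnonneg : ∀ x ∈ Ioo s ℓ, 0 ≤ 2 * √x / x ^ 2 := fun x _ => by positivity
  have hint : IntegrableOn (fun x : ℝ => 2 * √x / x ^ 2) (Ioo s ℓ) volume := by
    have hc' : ContinuousOn (fun x : ℝ => 2 * √x / x ^ 2) (Icc s ℓ) := hcont.mono (by rw [uIcc_of_le hℓ.le])
    exact hc'.integrableOn_Icc.mono_set Ioo_subset_Icc_self
  have hlin : ∫⁻ x in Ioo s ℓ, ENNReal.ofReal (2 * √x / x ^ 2) =
      ENNReal.ofReal (4 * (√s)⁻¹ - 4 * (√ℓ)⁻¹) := by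
    rw [← ofReal_integral_eq_lintegral_ofReal hint
      ((ae_restrict_iff' measurableSet_Ioo).2 (ae_of_all _ hnonneg)),
      ← integral_Ioc_eq_integral_Ioo, ← intervalIntegral.integral_of_le hℓ.le, hval]
    congr 1
    ring
  rw [hlin, ← ENNReal.ofReal_mul (Real.sqrt_nonneg _)]
  have h4 : √s * (4 * (√s)⁻¹ - 4 * (√ℓ)⁻¹) ≤ 4 := by
    have hs' : 0 < √s := Real.sqrt_pos.2 hs
    have hl' : 0 ≤ (√ℓ)⁻¹ := inv_nonneg.2 (Real.sqrt_nonneg _)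
    rw [mul_sub, ← mul_assoc, mul_comm (√s) 4, mul_assoc, mul_inv_cancel₀ hs'.ne', mul_one]
    nlinarith [mul_nonneg hs'.le hl']
  calc ENNReal.ofReal (√s * (4 * (√s)⁻¹ - 4 * (√ℓ)⁻¹)) ≤ ENNReal.ofReal 4 := ENNReal.ofReal_le_ofReal h4
    _ = 4 := by norm_num

/-- `(y^{1/2})² = y` in `[0, ∞]`. [folklore] -/
theorem rpow_half_sq (y : ℝ≥0∞) : (y ^ (1 / 2 : ℝ)) ^ 2 = y := by
  rw [← ENNReal.rpow_natCast, ← ENNReal.rpow_mul]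
  norm_num

/-! ## The weighted Cauchy–Schwarz step -/

/-- **Weighted Cauchy–Schwarz**: for `f ≥ 0` a.e.-measurable on `(0, x)`, `0 < x`,
`(∫₀ˣ f)² ≤ 2√x ∫₀ˣ √s f(s)² ds` (split `f = s^{-1/4} · s^{1/4} f` and use
`∫₀ˣ s^{-1/2} ds = 2√x`). [folklore] -/
theorem lintegral_Ioo_sq_le_sqrt_mul {f : ℝ → ℝ≥0∞} {x : ℝ} (hx : 0 < x)
    (hf : AEMeasurable f (volume.restrict (Ioo 0 x))) :
    (∫⁻ s in Ioo 0 x, f s) ^ 2 ≤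
      ENNReal.ofReal (2 * √x) * ∫⁻ s in Ioo 0 x, ENNReal.ofReal (√s) * f s ^ 2 := by
  set a : ℝ → ℝ≥0∞ := fun s => ENNReal.ofReal (√((√s)⁻¹)) with ha_def
  set b : ℝ → ℝ≥0∞ := fun s => ENNReal.ofReal (√(√s)) * f s with hb_def
  have ha : Measurable a := by
    simp only [ha_def]
    fun_prop
  have hb : AEMeasurable b (volume.restrict (Ioo 0 x)) := by
    simp only [hb_def]
    exact (Measurable.aemeasurable (by fun_prop)).mul hf
  have hab : ∀ s ∈ Ioo (0 : ℝ) x, (a * b) s = f s := by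
    intro s hs
    have hs' : 0 < √s := Real.sqrt_pos.2 hs.1
    simp only [Pi.mul_apply, ha_def, hb_def]
    rw [← mul_assoc, ← ENNReal.ofReal_mul (Real.sqrt_nonneg _),
      ← Real.sqrt_mul (inv_nonneg.2 hs'.le), inv_mul_cancel₀ hs'.ne', Real.sqrt_one,
      ENNReal.ofReal_one, one_mul]
  have ha2 : ∀ s ∈ Ioo (0 : ℝ) x, a s ^ (2 : ℝ) = ENNReal.ofReal ((√s)⁻¹) := by
    intro s _
    simp only [ha_def]
    rw [ENNReal.rpow_two, ← ENNReal.ofReal_pow (Real.sqrt_nonneg _),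
      Real.sq_sqrt (inv_nonneg.2 (Real.sqrt_nonneg _))]
  have hb2 : ∀ s, b s ^ (2 : ℝ) = ENNReal.ofReal (√s) * f s ^ 2 := by
    intro s
    simp only [hb_def]
    rw [ENNReal.rpow_two, mul_pow, ← ENNReal.ofReal_pow (Real.sqrt_nonneg _),
      Real.sq_sqrt (Real.sqrt_nonneg _)]
  have hH := ENNReal.lintegral_mul_le_Lp_mul_Lq (volume.restrict (Ioo 0 x))
    Real.HolderConjugate.two_two ha.aemeasurable hb
  have h1 : ∫⁻ s in Ioo 0 x, (a * b) s = ∫⁻ s in Ioo 0 x, f s :=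
    setLIntegral_congr_fun measurableSet_Ioo hab
  have h2 : ∫⁻ s in Ioo 0 x, a s ^ (2 : ℝ) = ENNReal.ofReal (2 * √x) := by
    rw [setLIntegral_congr_fun measurableSet_Ioo ha2]
    exact lintegral_Ioo_inv_sqrt hx
  have h3 : ∫⁻ s in Ioo 0 x, b s ^ (2 : ℝ) = ∫⁻ s in Ioo 0 x, ENNReal.ofReal (√s) * f s ^ 2 := by
    simp_rw [hb2]
  rw [h1, h2, h3] at hH
  calc (∫⁻ s in Ioo 0 x, f s) ^ 2
      ≤ ((ENNReal.ofReal (2 * √x)) ^ (1 / (2 : ℝ)) *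
          (∫⁻ s in Ioo 0 x, ENNReal.ofReal (√s) * f s ^ 2) ^ (1 / (2 : ℝ))) ^ 2 := by
        gcongr
    _ = ENNReal.ofReal (2 * √x) * ∫⁻ s in Ioo 0 x, ENNReal.ofReal (√s) * f s ^ 2 := by
        rw [mul_pow, rpow_half_sq, rpow_half_sq]

/-! ## Hardy's inequality for primitives of nonnegative functions -/

/-- **Hardy's inequality (`p = 2`) for primitives, `[0, ∞]`-valued form.** For `f : ℝ → [0, ∞]`
a.e.-measurable on `(0, ℓ)`,
`∫⁻_{x ∈ (0,ℓ)} (∫⁻_{(0,x)} f)² / x² ≤ 4 ∫⁻_{(0,ℓ)} f²`.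
Hardy–Littlewood–Pólya, *Inequalities*, Thm. 327 (there on `(0, ∞)` with strict inequality unless
`f ≡ 0`; the finite-interval statement follows by extending `f` by zero). Proof by the weighted
Cauchy–Schwarz inequality `lintegral_Ioo_sq_le_sqrt_mul` and Tonelli on the triangle
`0 < s < x < ℓ`, with `√s ∫ₛ^ℓ 2√x/x² dx ≤ 4`. [cite: HardyLittlewoodPolya1952, Thm. 327] -/
theorem lintegral_sq_primitive_div_sq_le {f : ℝ → ℝ≥0∞} {ℓ : ℝ}
    (hf : AEMeasurable f (volume.restrict (Ioo 0 ℓ))) :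
    ∫⁻ x in Ioo 0 ℓ, (∫⁻ s in Ioo 0 x, f s) ^ 2 / ENNReal.ofReal (x ^ 2) ≤
      4 * ∫⁻ s in Ioo 0 ℓ, f s ^ 2 := by
  -- the kernel `c(x) = 2√x/x²` and the weight `w(s) = √s`
  set c : ℝ → ℝ≥0∞ := fun x => ENNReal.ofReal (2 * √x / x ^ 2) with hc_def
  set w : ℝ → ℝ≥0∞ := fun s => ENNReal.ofReal (√s) with hw_def
  have hc : Measurable c := by simp only [hc_def]; fun_prop
  have hw : Measurable w := by simp only [hw_def]; fun_prop
  -- Step 1: pointwise bound by an inner integral over `(0, ℓ)`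
  have hpt : ∀ x ∈ Ioo 0 ℓ, (∫⁻ s in Ioo 0 x, f s) ^ 2 / ENNReal.ofReal (x ^ 2) ≤
      ∫⁻ s in Ioo 0 ℓ, (Iio x).indicator (fun s => c x * (w s * f s ^ 2)) s := by
    intro x hx
    have hset : Iio x ∩ Ioo 0 ℓ = Ioo 0 x := by
      ext s
      simp only [mem_inter_iff, mem_Iio, mem_Ioo]
      constructor
      · rintro ⟨h1, h2, _⟩; exact ⟨h2, h1⟩
      · rintro ⟨h1, h2⟩; exact ⟨h2, h1, h2.trans hx.2⟩
    rw [lintegral_indicator measurableSet_Iio, Measure.restrict_restrict measurableSet_Iio, hset,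
      lintegral_const_mul' _ _ ENNReal.ofReal_ne_top]
    have hfx : AEMeasurable f (volume.restrict (Ioo 0 x)) :=
      hf.mono_measure (Measure.restrict_mono (Ioo_subset_Ioo_right hx.2.le) le_rfl)
    have hx2 : 0 < x ^ 2 := pow_pos hx.1 2
    rw [ENNReal.ofReal_div_of_pos hx2, ENNReal.div_eq_inv_mul, ENNReal.div_eq_inv_mul, mul_assoc]
    gcongr
    exact lintegral_Ioo_sq_le_sqrt_mul hx.1 hfx
  -- measurability on the product for Tonelli
  have hF : AEMeasurable (Function.uncurry fun x s => (Iio x).indicator (fun s => c x * (w s * f s ^ 2)) s)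
      ((volume.restrict (Ioo (0 : ℝ) ℓ)).prod (volume.restrict (Ioo (0 : ℝ) ℓ))) := by
    have heq : (Function.uncurry fun x s => (Iio x).indicator (fun s => c x * (w s * f s ^ 2)) s) =
        {p : ℝ × ℝ | p.2 < p.1}.indicator (fun p => c p.1 * (w p.2 * f p.2 ^ 2)) := by
      funext p
      rcases p with ⟨x, s⟩
      simp only [Function.uncurry_apply_pair, indicator_apply, mem_Iio, mem_setOf_eq]
    rw [heq]
    refine AEMeasurable.indicator ?_ (measurableSet_lt measurable_snd measurable_fst)
    have hf2 : AEMeasurable (fun p : ℝ × ℝ => f p.2)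
        ((volume.restrict (Ioo (0 : ℝ) ℓ)).prod (volume.restrict (Ioo (0 : ℝ) ℓ))) :=
      hf.comp_quasiMeasurePreserving Measure.quasiMeasurePreserving_snd
    exact (hc.comp measurable_fst).aemeasurable.mul
      ((hw.comp measurable_snd).aemeasurable.mul (hf2.pow_const 2))
  -- Step 2: the inner `x`-integral for fixed `s`
  have hinner : ∀ s ∈ Ioo 0 ℓ,
      ∫⁻ x in Ioo 0 ℓ, (Iio x).indicator (fun s => c x * (w s * f s ^ 2)) s =
        (w s * ∫⁻ x in Ioo s ℓ, c x) * f s ^ 2 := by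
    intro s hs
    have hind : ∀ x, (Iio x).indicator (fun s => c x * (w s * f s ^ 2)) s =
        (Ioi s).indicator (fun x => c x * (w s * f s ^ 2)) x := by
      intro x
      simp only [indicator_apply, mem_Iio, mem_Ioi]
    have hset : Ioi s ∩ Ioo 0 ℓ = Ioo s ℓ := by
      ext x
      simp only [mem_inter_iff, mem_Ioi, mem_Ioo]
      constructor
      · rintro ⟨h1, _, h3⟩; exact ⟨h1, h3⟩
      · rintro ⟨h1, h2⟩; exact ⟨h1, hs.1.trans h1, h2⟩
    simp_rw [hind]
    rw [lintegral_indicator measurableSet_Ioi, Measure.restrict_restrict measurableSet_Ioi, hset,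
      lintegral_mul_const _ hc]
    ring
  -- Step 3: assemble
  calc ∫⁻ x in Ioo 0 ℓ, (∫⁻ s in Ioo 0 x, f s) ^ 2 / ENNReal.ofReal (x ^ 2)
      ≤ ∫⁻ x in Ioo 0 ℓ, ∫⁻ s in Ioo 0 ℓ, (Iio x).indicator (fun s => c x * (w s * f s ^ 2)) s :=
        setLIntegral_mono' measurableSet_Ioo hpt
    _ = ∫⁻ s in Ioo 0 ℓ, ∫⁻ x in Ioo 0 ℓ, (Iio x).indicator (fun s => c x * (w s * f s ^ 2)) s :=
        lintegral_lintegral_swap hF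
    _ = ∫⁻ s in Ioo 0 ℓ, (w s * ∫⁻ x in Ioo s ℓ, c x) * f s ^ 2 :=
        setLIntegral_congr_fun measurableSet_Ioo hinner
    _ ≤ ∫⁻ s in Ioo 0 ℓ, 4 * f s ^ 2 :=
        setLIntegral_mono' measurableSet_Ioo fun s hs =>
          mul_le_mul_left (sqrt_mul_lintegral_Ioo_kernel_le hs.1 ℓ) _
    _ = 4 * ∫⁻ s in Ioo 0 ℓ, f s ^ 2 := lintegral_const_mul' _ _ (by norm_num)

/-! ## Hardy's inequality for Bochner primitives -/

section Bochner

variable {E : Type*} [NormedAddCommGroup E] [NormedSpace ℝ E]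

/-- Translating a set integral on the line: `∫⁻_{(0,ℓ)} G(x + b) dx = ∫⁻_{(b, b+ℓ)} G`. [folklore] -/
theorem setLIntegral_Ioo_comp_add_right (G : ℝ → ℝ≥0∞) (b ℓ : ℝ) :
    ∫⁻ x in Ioo 0 ℓ, G (x + b) = ∫⁻ t in Ioo b (b + ℓ), G t := by
  have h := (measurePreserving_add_right volume b).setLIntegral_comp_preimage_emb
    (measurableEmbedding_addRight b) G (Ioo b (b + ℓ))
  rw [preimage_add_const_Ioo, sub_self, add_sub_cancel_left] at h
  exact h

/-- The norm of a Bochner primitive is bounded by the primitive of the norm: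
`‖∫_b^{x+b} h‖ₑ ≤ ∫⁻_{(0,x)} ‖h(s + b)‖ₑ ds` for `0 ≤ x`. [folklore] -/
theorem enorm_intervalIntegral_le_lintegral_Ioo (h : ℝ → E) (b : ℝ) {x : ℝ} (hx : 0 ≤ x) :
    ‖∫ s in b..x + b, h s‖ₑ ≤ ∫⁻ s in Ioo 0 x, ‖h (s + b)‖ₑ := by
  rw [intervalIntegral.integral_of_le (by linarith), integral_Ioc_eq_integral_Ioo]
  calc ‖∫ s in Ioo b (x + b), h s‖ₑ ≤ ∫⁻ s in Ioo b (x + b), ‖h s‖ₑ := enorm_integral_le_lintegral_enorm _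
    _ = ∫⁻ s in Ioo 0 x, ‖h (s + b)‖ₑ := by
        rw [setLIntegral_Ioo_comp_add_right (fun s => ‖h s‖ₑ) b x, add_comm x b]

/-- **Hardy's inequality at a left endpoint** (`p = 2`, Bochner form). For `h : ℝ → E`
a.e.-strongly measurable on `(b, b + ℓ)`,
`∫⁻_{t ∈ (b, b+ℓ)} ‖∫_b^t h‖² / (t - b)² ≤ 4 ∫⁻_{(b, b+ℓ)} ‖h‖²`:
for an absolutely continuous `u` on `[b, b + ℓ]` with `u(b) = 0` and `u' = h`, this is
`∫ ‖u(t)‖²/(t - b)² dt ≤ 4 ∫ ‖u'‖²`. Hardy–Littlewood–Pólya Thm. 327 (via `‖∫ h‖ ≤ ∫ ‖h‖` and the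
`[0, ∞]`-valued form `lintegral_sq_primitive_div_sq_le`). [cite: HardyLittlewoodPolya1952, Thm. 327] -/
theorem lintegral_enorm_sq_intervalIntegral_div_sq_le {h : ℝ → E} {b ℓ : ℝ}
    (hh : AEStronglyMeasurable h (volume.restrict (Ioo b (b + ℓ)))) :
    ∫⁻ t in Ioo b (b + ℓ), ‖∫ s in b..t, h s‖ₑ ^ 2 / ENNReal.ofReal ((t - b) ^ 2) ≤
      4 * ∫⁻ t in Ioo b (b + ℓ), ‖h t‖ₑ ^ 2 := by
  -- translate to `(0, ℓ)`
  set f : ℝ → ℝ≥0∞ := fun s => ‖h (s + b)‖ₑ with hf_def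
  have hmp : MeasurePreserving (fun s : ℝ => s + b) (volume.restrict (Ioo 0 ℓ))
      (volume.restrict (Ioo b (b + ℓ))) := by
    have h1 := (measurePreserving_add_right volume b).restrict_preimage_emb
      (measurableEmbedding_addRight b) (Ioo b (b + ℓ))
    rwa [preimage_add_const_Ioo, sub_self, add_sub_cancel_left] at h1
  have hf : AEMeasurable f (volume.restrict (Ioo 0 ℓ)) :=
    (hh.comp_measurePreserving hmp).enorm
  rw [← setLIntegral_Ioo_comp_add_right (fun t => ‖∫ s in b..t, h s‖ₑ ^ 2 / ENNReal.ofReal ((t - b) ^ 2)) b ℓ,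
    ← setLIntegral_Ioo_comp_add_right (fun t => ‖h t‖ₑ ^ 2) b ℓ]
  simp only [add_sub_cancel_right]
  calc ∫⁻ x in Ioo 0 ℓ, ‖∫ s in b..x + b, h s‖ₑ ^ 2 / ENNReal.ofReal (x ^ 2)
      ≤ ∫⁻ x in Ioo 0 ℓ, (∫⁻ s in Ioo 0 x, f s) ^ 2 / ENNReal.ofReal (x ^ 2) := by
        refine setLIntegral_mono' measurableSet_Ioo fun x hx => ?_
        gcongr
        exact enorm_intervalIntegral_le_lintegral_Ioo h b hx.1.le
    _ ≤ 4 * ∫⁻ s in Ioo 0 ℓ, f s ^ 2 := lintegral_sq_primitive_div_sq_le hf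

/-- **Hardy's inequality at a right endpoint** (mirror image): for `h : ℝ → E` a.e.-strongly
measurable on `(b - ℓ, b)`, `∫⁻_{t ∈ (b-ℓ, b)} ‖∫_t^b h‖² / (b - t)² ≤ 4 ∫⁻_{(b-ℓ, b)} ‖h‖²`
(reflect `s ↦ -s` and apply `lintegral_enorm_sq_intervalIntegral_div_sq_le`).
[cite: HardyLittlewoodPolya1952, Thm. 327] -/
theorem lintegral_enorm_sq_intervalIntegral_div_sq_le_right {h : ℝ → E} {b ℓ : ℝ}
    (hh : AEStronglyMeasurable h (volume.restrict (Ioo (b - ℓ) b))) :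
    ∫⁻ t in Ioo (b - ℓ) b, ‖∫ s in t..b, h s‖ₑ ^ 2 / ENNReal.ofReal ((b - t) ^ 2) ≤
      4 * ∫⁻ t in Ioo (b - ℓ) b, ‖h t‖ₑ ^ 2 := by
  -- reflected data
  have hneg : MeasurePreserving (fun s : ℝ => -s) volume volume := Measure.measurePreserving_neg volume
  have hemb : MeasurableEmbedding (fun s : ℝ => -s) := (MeasurableEquiv.neg ℝ).measurableEmbedding
  have hpre : (fun s : ℝ => -s) ⁻¹' Ioo (b - ℓ) b = Ioo (-b) (-b + ℓ) := by
    ext s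
    simp only [mem_preimage, mem_Ioo]
    constructor <;> rintro ⟨h1, h2⟩ <;> constructor <;> linarith
  have hmp : MeasurePreserving (fun s : ℝ => -s) (volume.restrict (Ioo (-b) (-b + ℓ)))
      (volume.restrict (Ioo (b - ℓ) b)) := by
    have h1 := hneg.restrict_preimage_emb hemb (Ioo (b - ℓ) b)
    rwa [hpre] at h1
  have hh' : AEStronglyMeasurable (fun s => h (-s)) (volume.restrict (Ioo (-b) (-b + ℓ))) :=
    hh.comp_measurePreserving hmp
  have key := lintegral_enorm_sq_intervalIntegral_div_sq_le hh'
  -- transport both sides back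
  have hL : ∫⁻ t in Ioo (-b) (-b + ℓ), ‖∫ s in -b..t, h (-s)‖ₑ ^ 2 / ENNReal.ofReal ((t - -b) ^ 2) =
      ∫⁻ t in Ioo (b - ℓ) b, ‖∫ s in t..b, h s‖ₑ ^ 2 / ENNReal.ofReal ((b - t) ^ 2) := by
    have h1 := hneg.setLIntegral_comp_preimage_emb hemb
      (fun t => ‖∫ s in t..b, h s‖ₑ ^ 2 / ENNReal.ofReal ((b - t) ^ 2)) (Ioo (b - ℓ) b)
    rw [hpre] at h1
    rw [← h1]
    refine setLIntegral_congr_fun measurableSet_Ioo fun t _ => ?_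
    simp only [intervalIntegral.integral_comp_neg, neg_neg, sub_neg_eq_add]
    congr 2
    ring
  have hR : ∫⁻ t in Ioo (-b) (-b + ℓ), ‖h (-t)‖ₑ ^ 2 = ∫⁻ t in Ioo (b - ℓ) b, ‖h t‖ₑ ^ 2 := by
    have h1 := hneg.setLIntegral_comp_preimage_emb hemb (fun t => ‖h t‖ₑ ^ 2) (Ioo (b - ℓ) b)
    rw [hpre] at h1
    exact h1
  rw [hL, hR] at key
  exact key

end Bochner

end Literature.Analysis.Calculus

end
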